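import Summits.Parity.GeneralizedHardyLittlewood.Theorems.BeyondDiagonalBeatsQuarter.OffDiagCoreKernels
import Summits.Parity.GeneralizedHardyLittlewood.Theorems.BeyondDiagonalBeatsQuarter.OffDiagFlatnessCount
import HarnessLib

/-!
# Route `PrimeLevelFamEdge`, crux K_B (stmt-Parity-20343), line `diagonal_kernel_split` rev 4, plan Ω —
# L7d part 2, node D6 `OffDiagSwitchClassFlatness`: **the FLATNESS of the switched classes — for fixed Petersson index `c`,
# dual modulus `h₁ ≠ 0`, shift `s`, layer `(d₁, d₂)`: at most `τ(|h₁|)·(M/d₁)·((M/d₂)/|h₁|) + M/d₁` source pairs `(l, m)`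
# land in any one class `switchClass c ((l/d₁)(m/d₂)) s h₁`**

L7D-PLAN §3 D6. The a8R family of `coreL` is indexed by `(cell, h₁, s)`; the large sieve with multiplicity
(prover-7 `OffDiagLevelLargeSieve.norm_sum_mul_levelLargePart_le_of_multiplicity_zmod`) needs, for each reduced modulus
`n = switchMod c s h₁` and class `γ`, the number of members in the fibre. For fixed outer data `(c, h₁, s, d₁, d₂)` the modulus
is fixed and the class of a source `(l, m)` is `switchClass c A s h₁ = −(A/g)·((cs)/g)⁻¹ (mod n)`, `A = (l/d₁)(m/d₂)`,
`g = switchGcd c s h₁`; on the support (`g ∣ A`) the condition `switchClass = γ` lifts to ONE congruence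
`(l/d₁)(m/d₂) ≡ k(γ) (mod |h₁|)` (`switchClass_eq_iff_natAbs_congr`), so prover-4's bilinear count
`OffDiagFlatnessCount.card_filter_prod_natCast_mul_eq_le_real` (`#{(a,b) ≤ (L,M) : ab ≡ k (mod h)} ≤ τ(h)·L·(M/h) + L`, any `k`)
applies after the injection `(l,m) ↦ (l/d₁, m/d₂)`:

* `natAbs_eq_gcd_mul_switchMod` (`|h₁| = g·n`), `isUnit_switchUnit` (`(cs)/g` is a unit mod `n`);
* **`switchClass_eq_imp_natAbs_congr`** — `g ∣ A ∧ switchClass c A s h₁ = γ ⇒ (A : ZMod |h₁|) = k γ` with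
  `k γ = g · ((−γ·((cs)/g))).val`;
* **`card_filter_switchClass_eq_le`** — the count above (as reals).

Pure `ℤ`/`ZMod` algebra and counting; theorems only; standard axioms. Helper toward `stub_offDiagBelowSlack_io`; closes nothing.
«The programme SEARCHES and TYPES; no claim about Landau–Siegel zeros, Theorems 1–2 of arXiv:2211.02515 or
a repaired Margin232 until a kernel theorem says so.»
-/

namespace Summit.Parity.GeneralizedHardyLittlewood.Theorems.BeyondDiagonalBeatsQuarter.OffDiag

open Finset

/-! ### §1. The lift of the class condition to a congruence modulo `|h₁|` -/

/-- `|h₁| = g · n` with `g = switchGcd c s h₁`, `n = switchMod c s h₁`. [folklore] -/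
theorem natAbs_eq_switchGcd_mul_switchMod (c : ℕ) (s h₁ : ℤ) :
    h₁.natAbs = switchGcd c s h₁ * switchMod c s h₁ := by
  have hg : (switchGcd c s h₁ : ℤ) ∣ h₁ := natCast_switchGcd_dvd c s h₁
  have hmul : h₁ = (switchGcd c s h₁ : ℤ) * (h₁ / (switchGcd c s h₁ : ℤ)) := (Int.mul_ediv_cancel' hg).symm
  rw [switchMod]
  conv_lhs => rw [hmul]
  rw [Int.natAbs_mul, Int.natAbs_natCast]

/-- `(cs)/g` is a unit modulo `n = |h₁|/g` (`h₁ ≠ 0`). [folklore] -/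
theorem isUnit_switchUnit (c : ℕ) (s : ℤ) {h₁ : ℤ} (hh₁ : h₁ ≠ 0) :
    IsUnit ((((c : ℤ) * s / (switchGcd c s h₁ : ℤ) : ℤ) : ZMod (switchMod c s h₁))) := by
  rw [ZMod.coe_int_isUnit_iff_isCoprime, switchMod]
  have hcop := isCoprime_div_gcd (n := h₁) (m := (c : ℤ) * s) hh₁ (rfl : Int.gcd ((c : ℤ) * s) h₁ = switchGcd c s h₁)
  rcases Int.natAbs_eq (h₁ / (switchGcd c s h₁ : ℤ)) with h | h
  · rw [← h]; exact hcop.symm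
  · have h' : ((h₁ / (switchGcd c s h₁ : ℤ)).natAbs : ℤ) = -(h₁ / (switchGcd c s h₁ : ℤ)) := by linarith
    rw [h']; exact hcop.symm.neg_left

/-- **The class condition lifts to one congruence modulo `|h₁|`.** For `h₁ ≠ 0`, `g ∣ A` and `switchClass c A s h₁ = γ`:
`(A : ZMod |h₁|) = g · v` with `v = (−γ·((cs)/g)).val` (an integer in `[0, n)` depending on `γ` only). [folklore] -/
theorem switchClass_eq_imp_natAbs_congr (c : ℕ) (s : ℤ) {h₁ : ℤ} (hh₁ : h₁ ≠ 0) {A : ℤ}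
    (hg : (switchGcd c s h₁ : ℤ) ∣ A) (γ : ZMod (switchMod c s h₁)) (hcl : switchClass c A s h₁ = γ) :
    ((A : ℤ) : ZMod h₁.natAbs) =
      (((switchGcd c s h₁ : ℤ) * ((-γ * ((((c : ℤ) * s / (switchGcd c s h₁ : ℤ) : ℤ) : ZMod (switchMod c s h₁)))).val
        : ℕ) : ℤ) : ZMod h₁.natAbs) := by
  haveI : NeZero (switchMod c s h₁) := ⟨switchMod_ne_zero c s hh₁⟩
  have hu : IsUnit ((((c : ℤ) * s / (switchGcd c s h₁ : ℤ) : ℤ) : ZMod (switchMod c s h₁))) :=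
    isUnit_switchUnit c s hh₁
  -- from `switchClass = γ`: `(A/g : ZMod n) = −γ·u`
  have hAg : (((A / (switchGcd c s h₁ : ℤ) : ℤ)) : ZMod (switchMod c s h₁)) =
      -γ * ((((c : ℤ) * s / (switchGcd c s h₁ : ℤ) : ℤ) : ZMod (switchMod c s h₁))) := by
    have h1 : switchClass c A s h₁ * ((((c : ℤ) * s / (switchGcd c s h₁ : ℤ) : ℤ) : ZMod (switchMod c s h₁))) =
        -(((A / (switchGcd c s h₁ : ℤ) : ℤ)) : ZMod (switchMod c s h₁)) := by
      rw [switchClass, mul_assoc, ZMod.inv_mul_of_unit _ hu, mul_one]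
    rw [hcl] at h1
    have h2 := congrArg Neg.neg h1
    rw [neg_neg] at h2
    rw [← h2, neg_mul]
  -- lift: `n ∣ v − A/g`, multiply by `g`
  set v : ℕ := (-γ * ((((c : ℤ) * s / (switchGcd c s h₁ : ℤ) : ℤ) : ZMod (switchMod c s h₁)))).val with hvdef
  have hv : (((A / (switchGcd c s h₁ : ℤ) : ℤ)) : ZMod (switchMod c s h₁)) = ((v : ℤ) : ZMod (switchMod c s h₁)) := by
    rw [hAg, Int.cast_natCast, hvdef, ZMod.natCast_zmod_val]
  rw [ZMod.intCast_eq_intCast_iff_dvd_sub] at hv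
  obtain ⟨t, ht⟩ := hv
  have hA : A = (switchGcd c s h₁ : ℤ) * (A / (switchGcd c s h₁ : ℤ)) := (Int.mul_ediv_cancel' hg).symm
  rw [ZMod.intCast_eq_intCast_iff_dvd_sub]
  refine ⟨t, ?_⟩
  have hgn : ((h₁.natAbs : ℕ) : ℤ) = (switchGcd c s h₁ : ℤ) * (switchMod c s h₁ : ℤ) := by
    rw [natAbs_eq_switchGcd_mul_switchMod c s h₁]; push_cast; rfl
  calc (switchGcd c s h₁ : ℤ) * (v : ℕ) - A
      = (switchGcd c s h₁ : ℤ) * ((v : ℤ) - A / (switchGcd c s h₁ : ℤ)) := by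
        conv_lhs => rw [hA]
        ring
    _ = (switchGcd c s h₁ : ℤ) * ((switchMod c s h₁ : ℤ) * t) := by rw [ht]
    _ = ((h₁.natAbs : ℕ) : ℤ) * t := by rw [hgn]; ring

/-! ### §2. The count -/

/-- **Flatness of the switched classes.** For `c`, `h₁ ≠ 0`, `s`, `M`, `d₁, d₂ ≥ 1` and any class `γ` of the reduced modulus:
`#{(l,m) ∈ [1,M]² : d₁ ∣ l, d₂ ∣ m, g ∣ (l/d₁)(m/d₂), switchClass c ((l/d₁)(m/d₂)) s h₁ = γ} ≤ τ(|h₁|)·(M/d₁)·((M/d₂)/|h₁|) + M/d₁`.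
[folklore] -/
theorem card_filter_switchClass_eq_le (c : ℕ) (s : ℤ) {h₁ : ℤ} (hh₁ : h₁ ≠ 0) (M : ℕ) {d₁ d₂ : ℕ} (hd₁ : 0 < d₁)
    (hd₂ : 0 < d₂) (γ : ZMod (switchMod c s h₁)) :
    (((Icc 1 M ×ˢ Icc 1 M).filter (fun p : ℕ × ℕ ↦ d₁ ∣ p.1 ∧ d₂ ∣ p.2 ∧
        (switchGcd c s h₁ : ℤ) ∣ ((p.1 / d₁ : ℕ) : ℤ) * (p.2 / d₂ : ℕ) ∧
        switchClass c (((p.1 / d₁ : ℕ) : ℤ) * (p.2 / d₂ : ℕ)) s h₁ = γ)).card : ℝ) ≤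
      (h₁.natAbs.divisors.card : ℝ) * (M / d₁ : ℕ) * (((M / d₂ : ℕ) : ℝ) / h₁.natAbs) + (M / d₁ : ℕ) := by
  haveI : NeZero (switchMod c s h₁) := ⟨switchMod_ne_zero c s hh₁⟩
  have hH : 0 < h₁.natAbs := Int.natAbs_pos.mpr hh₁
  set g : ℕ := switchGcd c s h₁ with hgdef
  set k : ZMod h₁.natAbs := (((g : ℤ) * ((-γ * ((((c : ℤ) * s / (g : ℤ) : ℤ) : ZMod (switchMod c s h₁)))).val
        : ℕ) : ℤ) : ZMod h₁.natAbs) with hkdef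
  set S := (Icc 1 M ×ˢ Icc 1 M).filter (fun p : ℕ × ℕ ↦ d₁ ∣ p.1 ∧ d₂ ∣ p.2 ∧
        (g : ℤ) ∣ ((p.1 / d₁ : ℕ) : ℤ) * (p.2 / d₂ : ℕ) ∧
        switchClass c (((p.1 / d₁ : ℕ) : ℤ) * (p.2 / d₂ : ℕ)) s h₁ = γ) with hS
  set T := (Icc 1 (M / d₁) ×ˢ Icc 1 (M / d₂)).filter
      (fun p : ℕ × ℕ ↦ (p.1 : ZMod h₁.natAbs) * (p.2 : ZMod h₁.natAbs) = k) with hT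
  -- the injection `(l,m) ↦ (l/d₁, m/d₂)` of `S` into `T`
  have hmaps : ∀ p ∈ S, (p.1 / d₁, p.2 / d₂) ∈ T := by
    intro p hp
    rw [hS, Finset.mem_filter, Finset.mem_product, Finset.mem_Icc, Finset.mem_Icc] at hp
    obtain ⟨⟨⟨hl1, hlM⟩, hm1, hmM⟩, hdl, hdm, hgA, hcl⟩ := hp
    rw [hT, Finset.mem_filter, Finset.mem_product, Finset.mem_Icc, Finset.mem_Icc]
    refine ⟨⟨⟨Nat.div_pos (Nat.le_of_dvd (by omega) hdl) hd₁, Nat.div_le_div_right hlM⟩,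
      Nat.div_pos (Nat.le_of_dvd (by omega) hdm) hd₂, Nat.div_le_div_right hmM⟩, ?_⟩
    have h := switchClass_eq_imp_natAbs_congr c s hh₁ hgA γ hcl
    rw [Int.cast_mul, Int.cast_natCast, Int.cast_natCast] at h
    rw [h]
  have hinj : Set.InjOn (fun p : ℕ × ℕ ↦ (p.1 / d₁, p.2 / d₂)) S := by
    intro p hp p' hp' heq
    rw [hS, Finset.mem_coe, Finset.mem_filter] at hp hp'
    obtain ⟨h1, h2⟩ := Prod.mk.inj heq
    have e1 : p.1 = p'.1 := by
      rw [← Nat.div_mul_cancel hp.2.1, ← Nat.div_mul_cancel hp'.2.1, h1]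
    have e2 : p.2 = p'.2 := by
      rw [← Nat.div_mul_cancel hp.2.2.1, ← Nat.div_mul_cancel hp'.2.2.1, h2]
    exact Prod.ext e1 e2
  have hcard : S.card ≤ T.card := Finset.card_le_card_of_injOn _ hmaps hinj
  calc (S.card : ℝ) ≤ T.card := by exact_mod_cast hcard
    _ ≤ _ := card_filter_prod_natCast_mul_eq_le_real hH (M / d₁) (M / d₂) k

end Summit.Parity.GeneralizedHardyLittlewood.Theorems.BeyondDiagonalBeatsQuarter.OffDiag
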